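import Literature.Barriers.CriticalPhenomena.PlaquetteWalkHoleRootHoleColumnSevenTurns
import HarnessLib

/-!
# Barrier catalogue (SAWScalingLimit): in the HOLE COLUMN BELOW the hole the straight level-`7` class-`B2a` member has EXACTLY SEVEN isolated turns, named — the row-mirror of
`PlaquetteWalkHoleRootHoleColumnSevenTurns` («HOLE COLUMN: THE SEVEN TURNS BELOW»)

`Z → ∞` limit model of the printed Yang–Baxter weights [GlazmanManolescu2019, §1, eq. (1)]; the «RECTANGLE COEFFICIENT» line (b-engine-1 g28). The export lemma of the
HOLE-COLUMN programme on the other side of the hole, by the reflection `ω.mirrorAt` in the root row [GlazmanManolescu2019, §4.2] (`facesL_map_mirrorRow`,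
`kindsL_map_mirrorRow`, `YBWalk.fc_eq_of_mids_mirror`, `YBWalk.sIn_sOut_eq_of_mids_mirror`):

* ★★ `ΩG.usesSide_mirrorAt_iff`: the reflected walk uses side `s` of `c` iff the walk uses the reflected side of the reflected plaquette.
* ★★★ `ΩG.sevenTurns_of_cost_seven_straight_holeColumn_below`: for `r` strictly below the hole, some arc strictly below the row of `r`: top row `Y > w.2`, bottom row
  `Y' < r.2`, two distinct top-row and two distinct bottom-row cells, the root-row cell `(τ1, w.2)`, the chain ends `(r.1 ∓ M, r.2)` with their chain data — seven isolated
  turns, and every isolated turn is one of them.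

[GlazmanManolescu2019 §1 Fig. 1, eq. (1), Lemma 2.1, Remark 2.2, §4.2; Glazman2015WeightedSAW Lemma 3.1 (proof, pp. 6–7); CourantRobbins1958 Ch. V App. §2]
-/

noncomputable section

namespace Literature.Probability.RandomPlanarGeometry.SAW.YangBaxter

open Real
open Literature.Barriers.CriticalPhenomena.PlaquetteWalk

namespace ΩG

variable {D : Set Face} {w r : Face} {ω : ΩG D (w.side .W) r}

/-- ★★ **Side uses under the root-row reflection.** The reflected walk `ω.mirrorAt` uses side `s` of the plaquette `c` iff `ω` uses side `mirrorSide s` of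
`mirrorRowFace w.2 c`. [cite: GlazmanManolescu2019, §4.2 (lattice symmetries)] -/
theorem usesSide_mirrorAt_iff (c : Face) (s : Side) :
    ω.mirrorAt.2.UsesSide c s ↔ ω.2.UsesSide (mirrorRowFace w.2 c) (mirrorSide s) := by
  have hlen : ω.mirrorAt.2.arcs.length = ω.2.arcs.length := YBWalk.length_arcs_eq_of_mids_mirror ω.mirrorAt_mids
  constructor
  · rintro ⟨j, hj, hfc, hs⟩
    rw [hlen] at hj
    obtain ⟨e1, e2⟩ := YBWalk.sIn_sOut_eq_of_mids_mirror ω.mirrorAt_mids (i := j) hj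
    rw [YBWalk.fc_eq_of_mids_mirror ω.mirrorAt_mids hj] at hfc
    refine ⟨j, hj, by rw [← hfc, mirrorRowFace_mirrorRowFace], ?_⟩
    rcases hs with h1 | h2
    · left; rw [e1] at h1; rw [← h1, mirrorSide_mirrorSide]
    · right; rw [e2] at h2; rw [← h2, mirrorSide_mirrorSide]
  · rintro ⟨j, hj, hfc, hs⟩
    obtain ⟨e1, e2⟩ := YBWalk.sIn_sOut_eq_of_mids_mirror ω.mirrorAt_mids (i := j) hj
    refine ⟨j, by rw [hlen]; exact hj, ?_, ?_⟩
    · rw [YBWalk.fc_eq_of_mids_mirror ω.mirrorAt_mids hj, hfc, mirrorRowFace_mirrorRowFace]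
    · rcases hs with h1 | h2
      · left; rw [e1, h1, mirrorSide_mirrorSide]
      · right; rw [e2, h2, mirrorSide_mirrorSide]

/-- ★★★ **HOLE COLUMN BELOW THE HOLE: THE SEVEN TURNS (export lemma, mirrored).** Let `ω` be a wound class-`B2a` walk of limit cost `7` from the hole root `w.side W`
(hole `(w.1 − 1, w.2)` absent) with a slanted end and a STRAIGHT first arc at a rhombus `r` of the hole column (`r.1 = w.1 − 1`) strictly below the hole, some arc of `ω`
lying strictly below the row of `r`. Then with the top row `Y` (`w.2 < Y`), the bottom row `Y'` (`Y' < r.2`), two distinct top-row cells `t₁, t₂`, two distinct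
bottom-row cells `b₁, b₂`, a root-row cell `(τ1, w.2)`, `τ1 ≥ w.1`, and the chain ends `(r.1 − MW, r.2)`, `(r.1 + ME, r.2)`, `MW, ME ≥ 1` (with the chain data of the
horizontal chains of `r`): the seven cells are isolated turns and every isolated turn of `ω` is one of the seven — the row-mirror [GlazmanManolescu2019, §4.2] of
`sevenTurns_of_cost_seven_straight_holeColumn_above`. [cite: GlazmanManolescu2019, §1, Fig. 1 and eq. (1); Lemma 2.1; Remark 2.2; §4.2] [cite: Glazman2015WeightedSAW,
Lemma 3.1 (proof, pp. 6–7)] [cite: CourantRobbins1958, Ch. V Appendix §2 (the even–odd rule)] -/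
theorem sevenTurns_of_cost_seven_straight_holeColumn_below (hh : holeFaceW w ∉ D) (hr : RootedFace D (w.side .W) r) (h : ω.IsB2a)
    (hA : ω.AJ hr h (toC (midPt (w.side .W))) ≠ 0) (hc : cost (slotOfSide ω.1) ω.2.mids = 7) (hz : ω.1 = .N ∨ ω.1 = .S)
    (hstr8 : arcKind (ω.2.sIn ω.2.firstHitG) (ω.2.sOut ω.2.firstHitG) = .straight) (hcol : r.1 = w.1 - 1) (hbelow : r.2 < w.2)
    (hdown : ∃ j < ω.2.arcs.length, (ω.2.fc j).2 < r.2) :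
    ∃ (Y Y' τ1 : ℤ) (MW ME : ℕ) (t₁ t₂ b₁ b₂ : Face),
      (∀ j < ω.2.arcs.length, (ω.2.fc j).2 ≤ Y) ∧ (∀ j < ω.2.arcs.length, Y' ≤ (ω.2.fc j).2) ∧ w.2 < Y ∧ Y' < r.2 ∧
      t₁.2 = Y ∧ t₂.2 = Y ∧ t₁ ≠ t₂ ∧ b₁.2 = Y' ∧ b₂.2 = Y' ∧ b₁ ≠ b₂ ∧ w.1 ≤ τ1 ∧ 1 ≤ MW ∧ 1 ≤ ME ∧
      (∀ m : ℕ, 1 ≤ m → m ≤ MW → ω.2.UsesSide (r.1 - m, r.2) .E) ∧ (∀ m : ℕ, m < MW → ω.2.UsesSide (r.1 - m, r.2) .W) ∧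
        ¬ω.2.UsesSide (r.1 - MW, r.2) .W ∧
      (∀ m : ℕ, 1 ≤ m → m ≤ ME → ω.2.UsesSide (r.1 + m, r.2) .W) ∧ (∀ m : ℕ, m < ME → ω.2.UsesSide (r.1 + m, r.2) .E) ∧
        ¬ω.2.UsesSide (r.1 + ME, r.2) .E ∧
      (∀ f ∈ ({t₁, t₂, b₁, b₂, ((τ1 : ℤ), w.2), ((r.1 : ℤ) - MW, r.2), ((r.1 : ℤ) + ME, r.2)} : Finset Face),
        f ∈ facesL ω.2.mids ∧ (kindsL ω.2.mids f = [.corner] ∨ kindsL ω.2.mids f = [.coCorner])) ∧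
      (∀ f : Face, f ∈ facesL ω.2.mids → (kindsL ω.2.mids f = [.corner] ∨ kindsL ω.2.mids f = [.coCorner]) →
        f ∈ ({t₁, t₂, b₁, b₂, ((τ1 : ℤ), w.2), ((r.1 : ℤ) - MW, r.2), ((r.1 : ℤ) + ME, r.2)} : Finset Face)) := by
  classical
  set n := ω.2.arcs.length with hn
  have hF := ω.fh_lt h
  -- reflect in the root row
  have hh' : holeFaceW w ∉ rowMirrorDom w D := by
    rw [mem_rowMirrorDom]
    have e : mirrorRowFace w.2 (holeFaceW w) = holeFaceW w := by
      simp only [mirrorRowFace, holeFaceW]; exact Prod.ext rfl (by simp only; ring)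
    rw [e]; exact hh
  have hr' := rootedFace_rowMirrorDom_mirrorRowFace (w := w) hr
  have h' := isB2a_mirrorAt hr h
  have hA' := AJ_mirrorAt_ne_zero hr h hA
  have hc' : cost (slotOfSide ω.mirrorAt.1) ω.mirrorAt.2.mids = 7 := by
    show cost (slotOfSide (mirrorSide ω.1)) (ω.2.mids.map (mirrorRow w.2)) = 7
    rw [cost_map_mirrorRow]; exact hc
  have hz' : ω.mirrorAt.1 = .N ∨ ω.mirrorAt.1 = .S := by
    show mirrorSide ω.1 = .N ∨ mirrorSide ω.1 = .S
    rcases hz with e | e <;> rw [e]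
    · exact Or.inr rfl
    · exact Or.inl rfl
  have hlen : ω.mirrorAt.2.arcs.length = n := YBWalk.length_arcs_eq_of_mids_mirror ω.mirrorAt_mids
  have hfcm : ∀ i < n, ω.mirrorAt.2.fc i = mirrorRowFace w.2 (ω.2.fc i) := fun i hi => YBWalk.fc_eq_of_mids_mirror ω.mirrorAt_mids hi
  have hFm : ω.mirrorAt.2.firstHitG = ω.2.firstHitG := YBWalk.firstHitG_eq_of_mids_mirror ω.mirrorAt_mids
  have hstr8' : arcKind (ω.mirrorAt.2.sIn ω.mirrorAt.2.firstHitG) (ω.mirrorAt.2.sOut ω.mirrorAt.2.firstHitG) = .straight := by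
    obtain ⟨e1, e2⟩ := YBWalk.sIn_sOut_eq_of_mids_mirror ω.mirrorAt_mids (i := ω.2.firstHitG) hF
    rw [hFm, e1, e2, arcKind_mirrorSide, hstr8]; rfl
  have hcol' : (mirrorRowFace w.2 r).1 = w.1 - 1 := by simp only [mirrorRowFace]; exact hcol
  have habove' : w.2 < (mirrorRowFace w.2 r).2 := by simp only [mirrorRowFace]; omega
  have hup' : ∃ j < ω.mirrorAt.2.arcs.length, (mirrorRowFace w.2 r).2 < (ω.mirrorAt.2.fc j).2 := by
    obtain ⟨j, hj, hjr⟩ := hdown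
    refine ⟨j, by rw [hlen]; exact hj, ?_⟩
    rw [hfcm j hj]; simp only [mirrorRowFace]; omega
  obtain ⟨Y, Y', τ1, MW, ME, t₁, t₂, b₁, b₂, hY, hY', hrY, hY'w, ht₁, ht₂, ht12, hb₁, hb₂, hb12, hτ1, hMW1, hME1,
    hEW, hWW, hnotW, hWE, hEE, hnotE, hseven, hall⟩ :=
    sevenTurns_of_cost_seven_straight_holeColumn_above (ω := ω.mirrorAt) hh' hr' h' hA' hc' hz' hstr8' hcol' habove' hup'
  rw [hlen] at hY hY'
  -- facesL / kindsL of the reflected walk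
  have hPiff : ∀ f : Face, (f ∈ facesL ω.mirrorAt.2.mids ∧ (kindsL ω.mirrorAt.2.mids f = [.corner] ∨ kindsL ω.mirrorAt.2.mids f = [.coCorner])) ↔
      (mirrorRowFace w.2 f ∈ facesL ω.2.mids ∧ (kindsL ω.2.mids (mirrorRowFace w.2 f) = [.corner] ∨ kindsL ω.2.mids (mirrorRowFace w.2 f) = [.coCorner])) := by
    intro f
    have e1 : facesL ω.mirrorAt.2.mids = (facesL ω.2.mids).map (mirrorRowFace w.2) := by
      rw [mirrorAt_mids]; exact facesL_map_mirrorRow w.2 ω.2.mids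
    have e2 : kindsL ω.mirrorAt.2.mids f = (kindsL ω.2.mids (mirrorRowFace w.2 f)).map mirrorKind := by
      have := kindsL_map_mirrorRow w.2 ω.2.mids (mirrorRowFace w.2 f)
      rw [mirrorRowFace_mirrorRowFace] at this
      rw [mirrorAt_mids]; exact this
    rw [e1, e2, List.mem_map]
    constructor
    · rintro ⟨⟨g, hg, hgf⟩, hk⟩
      refine ⟨by rw [← hgf, mirrorRowFace_mirrorRowFace]; exact hg, ?_⟩
      rcases hk with hk | hk
      · right
        have := congrArg (List.map mirrorKind) hk
        rw [List.map_map] at this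
        have hid : mirrorKind ∘ mirrorKind = id := by funext κ; simp
        rw [hid, List.map_id] at this
        exact this
      · left
        have := congrArg (List.map mirrorKind) hk
        rw [List.map_map] at this
        have hid : mirrorKind ∘ mirrorKind = id := by funext κ; simp
        rw [hid, List.map_id] at this
        exact this
    · rintro ⟨hg, hk⟩
      refine ⟨⟨mirrorRowFace w.2 f, hg, mirrorRowFace_mirrorRowFace _ _⟩, ?_⟩
      rcases hk with hk | hk
      · right; rw [hk]; rfl
      · left; rw [hk]; rfl
  -- the mirrored chain data on the row of `r`
  have hmr : ∀ x : ℤ, mirrorRowFace w.2 ((x, (mirrorRowFace w.2 r).2) : Face) = (x, r.2) := by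
    intro x; simp only [mirrorRowFace]; exact Prod.ext rfl (by simp only; ring)
  have hUE : ∀ x : ℤ, ω.mirrorAt.2.UsesSide (x, (mirrorRowFace w.2 r).2) .E ↔ ω.2.UsesSide (x, r.2) .E := by
    intro x; rw [usesSide_mirrorAt_iff, hmr]; rfl
  have hUW : ∀ x : ℤ, ω.mirrorAt.2.UsesSide (x, (mirrorRowFace w.2 r).2) .W ↔ ω.2.UsesSide (x, r.2) .W := by
    intro x; rw [usesSide_mirrorAt_iff, hmr]; rfl
  have hr1 : (mirrorRowFace w.2 r).1 = r.1 := rfl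
  simp only [hr1] at hEW hWW hnotW hWE hEE hnotE hseven hall
  refine ⟨2 * w.2 - Y', 2 * w.2 - Y, τ1, MW, ME, mirrorRowFace w.2 b₁, mirrorRowFace w.2 b₂, mirrorRowFace w.2 t₁, mirrorRowFace w.2 t₂,
    fun j hj => ?_, fun j hj => ?_, by omega, ?_, ?_, ?_, ?_, ?_, ?_, ?_, hτ1, hMW1, hME1,
    fun m hm1 hmM => (hUE _).1 (hEW m hm1 hmM), fun m hmM => (hUW _).1 (hWW m hmM), fun hu => hnotW ((hUW _).2 hu),
    fun m hm1 hmM => (hUW _).1 (hWE m hm1 hmM), fun m hmM => (hUE _).1 (hEE m hmM), fun hu => hnotE ((hUE _).2 hu), ?_, ?_⟩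
  · have := hY' j hj; rw [hfcm j hj] at this; simp only [mirrorRowFace] at this; omega
  · have := hY j hj; rw [hfcm j hj] at this; simp only [mirrorRowFace] at this; omega
  · simp only [mirrorRowFace] at hrY ⊢; omega
  · simp only [mirrorRowFace]; rw [hb₁]
  · simp only [mirrorRowFace]; rw [hb₂]
  · exact fun e => hb12 (mirrorRowFace_injective _ e)
  · simp only [mirrorRowFace]; rw [ht₁]
  · simp only [mirrorRowFace]; rw [ht₂]
  · exact fun e => ht12 (mirrorRowFace_injective _ e)
  · -- the seven reflected cells are isolated turns of `ω`
    intro f hf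
    have key : ∀ g : Face, (g ∈ facesL ω.mirrorAt.2.mids ∧ (kindsL ω.mirrorAt.2.mids g = [.corner] ∨ kindsL ω.mirrorAt.2.mids g = [.coCorner])) →
        mirrorRowFace w.2 g ∈ facesL ω.2.mids ∧
          (kindsL ω.2.mids (mirrorRowFace w.2 g) = [.corner] ∨ kindsL ω.2.mids (mirrorRowFace w.2 g) = [.coCorner]) := fun g hg => (hPiff g).1 hg
    have hτ : mirrorRowFace w.2 ((τ1, w.2) : Face) = (τ1, w.2) := by simp only [mirrorRowFace]; exact Prod.ext rfl (by simp only; ring)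
    have heW : mirrorRowFace w.2 ((r.1 - MW, (mirrorRowFace w.2 r).2) : Face) = (r.1 - MW, r.2) := hmr _
    have heE : mirrorRowFace w.2 ((r.1 + ME, (mirrorRowFace w.2 r).2) : Face) = (r.1 + ME, r.2) := hmr _
    simp only [Finset.mem_insert, Finset.mem_singleton] at hf
    rcases hf with rfl | rfl | rfl | rfl | rfl | rfl | rfl
    · exact key b₁ (hseven b₁ (by simp))
    · exact key b₂ (hseven b₂ (by simp))
    · exact key t₁ (hseven t₁ (by simp))
    · exact key t₂ (hseven t₂ (by simp))
    · rw [← hτ]; exact key _ (hseven _ (by simp))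
    · rw [← heW]; exact key _ (hseven _ (by simp))
    · rw [← heE]; exact key _ (hseven _ (by simp))
  · -- every isolated turn of `ω` is one of the seven reflected cells
    intro f hf hk
    have hP' := (hPiff (mirrorRowFace w.2 f)).2 (by rw [mirrorRowFace_mirrorRowFace]; exact ⟨hf, hk⟩)
    have hmem := hall _ hP'.1 hP'.2
    have hback : ∀ g : Face, mirrorRowFace w.2 f = g → f = mirrorRowFace w.2 g := by
      intro g e; rw [← e, mirrorRowFace_mirrorRowFace]
    simp only [Finset.mem_insert, Finset.mem_singleton] at hmem ⊢
    rcases hmem with e | e | e | e | e | e | e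
    · exact Or.inr (Or.inr (Or.inl (hback _ e)))
    · exact Or.inr (Or.inr (Or.inr (Or.inl (hback _ e))))
    · exact Or.inl (hback _ e)
    · exact Or.inr (Or.inl (hback _ e))
    · right; right; right; right; left
      rw [hback _ e]; simp only [mirrorRowFace]; exact Prod.ext rfl (by simp only; ring)
    · right; right; right; right; right; left
      rw [hback _ e]; exact hmr _
    · right; right; right; right; right; right
      rw [hback _ e]; exact hmr _

end ΩG

end Literature.Probability.RandomPlanarGeometry.SAW.YangBaxter
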